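import Literature.Probability.Percolation.MarkedLoopBoundarySpanCornerCriterion
import Literature.Probability.LatticeModels.TemperleyLiebCapContract
import HarnessLib

/-!
# Boundary span from TIGHTENING and the SIDEWAYS TOWER: the assembly criterion along a sub-family of marked domains («BSPAN-SIDEWAYS-CRITERION»)

Topic `Literature/Probability/Percolation`; generic-`k` layer of the marked-loop (Khristoforov–Smirnov) lineage; a rider on `MarkedLoopBoundarySpanCornerCriterion.lean`
(«BSPAN-CORNER-CRITERION»: ★★★ `bNonvanish_of_laws_stable_corners` — boundary non-degeneracy from stability of the span of ALL home-arc laws under the CORNER-PAIR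
generators `e_j`, `j ≤ k−2`, plus one realised pattern; via the head theorem with initial generators `span_eq_top_of_stable_initial`) and on
`LatticeModels/TemperleyLiebCapContract.lean` (★★ `tlL_one_eq_capInsL_comp_contractL`: `e_j = capInsL j ∘ contractL j` at loop weight `1`).

Two sharpenings, purely linear-algebraic, in the shape the lane's surgery calculus delivers (HOME `FINDING-BSPAN-SLIDE-INDUCTION.md` §4):

* ★★ `bNonvanish_of_subfamily_stable_corners` / `bSpan_of_subfamily_stable_corners(')` — the corner-pair criterion for an arbitrary SUB-FAMILY `T` of home-arc lawpoints: if
  the span of the laws of `T` is stable under every corner-pair generator and one pattern is realised at a member of `T`, then `BNonvanish k` / `BSpan k` (home arc, every arc);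
* ★ `tlL_one_mem_span_of_sideways` — **THE SIDEWAYS TOWER, algebraic skeleton**: if `contractL j L₀ = X₁ − X₀` (the one-hexagon contraction F2 at a tight pair),
  `capInsL j X₀ = L_h − L₀` (F1 on the same hexagon) and `capInsL j X₁ = L₂ − L₁` (F1 on a SECOND hexagon attached beside the first), then
  `e_j L₀ = L₂ − L₁ − L_h + L₀`, a combination of four laws of the same level (no hexagon is stacked on another, so every domain stays admissible);
* ★★★ `bNonvanish_of_tighten_sideways` / `bSpan_of_tighten_sideways'` — **THE ASSEMBLY CRITERION**: let `T` be a family of home-arc lawpoints of `k = 2m+1`-marked domains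
  containing one realised pattern. Suppose that for every corner pair `j ≤ k−2` and every member `z ∈ T` the law `lawLP z` lies in the span of the laws of those members
  `w ∈ T` that are «sideways tower-able at `j` inside `T`» — i.e. admit vectors `X₀, X₁` of the planar module of `k − 1` sites and members `w_h, w₁, w₂ ∈ T` with
  `contractL j (lawLP w) = X₁ − X₀`, `capInsL j X₀ = lawLP w_h − lawLP w`, `capInsL j X₁ = lawLP w₂ − lawLP w₁` (TIGHTENING). Then `BNonvanish k` and `BSpan k` hold on every
  arc.

The lane's intended instance (not in this file; numerics in the FINDING, §3–§4: tightening trees close at depth = gap length − 1 with tower-able leaves, the sideways identity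
holds in every instance checked): `T` = lawpoints of «sandpile» domains (a thick base with supported hanging cells, marks on the lower boundary); TIGHTENING = iterated
one-mark SLIDES `law(Ω ∪ h; u ↦ a) = law(Ω; u) + law(Ω; u ↦ q)`; `X₀ = law(Ω; M̂)`, `X₁ = law(Ω ∪ h; M̂)` for the hexagon `h` whose contact ends are the tight pair, `w_h` = the
pair moved onto `h`, `w₁, w₂` = the F1 pair of a second supported hexagon beside `h`. Nothing about their truth is claimed here.

## References
* M. Khristoforov, S. Smirnov, *Percolation and O(1) loop model*, arXiv:2111.15612 (2021), §1.2 (arXiv v1 p. 2: the law of the link pattern), §2 Lemma 4 (p. 4), eq. (4)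
  and Remark 6 (p. 5).
* D. Ridout, Y. Saint-Aubin, *Standard modules, induction and the structure of the Temperley–Lieb algebra*, Adv. Theor. Math. Phys. 18 (2014) = arXiv:1204.4505, §3 Prop.
  3.3 (arXiv p. 13).
* P. A. Pearce, V. Rittenberg, J. de Gier, B. Nienhuis, *Temperley–Lieb stochastic processes*, J. Phys. A 35 (2002) L661–L668, §2 (the monoid move `e_j`; cup–cap).

## Mathlib / tree
Tree: `MarkedLoopBoundarySpanCornerCriterion` (whole-family version, for comparison), `LatticeModels/TemperleyLiebPercolationHeadInitial` (`span_eq_top_of_stable_initial`),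
`LatticeModels/TemperleyLiebCapContract` (`capInsL`, `contractL`, `tlL_one_eq_capInsL_comp_contractL`), `MarkedLoopBoundarySpanCriterion` (`totalMass_lawLP_ne_zero`),
`MarkedLoopBoundaryLawModule` (`lawLP`, `bNonvanish_last_iff_span_lawLP`), `MarkedLoopBoundarySpan` (`ArcPoint`, `BSpan`, `BNonvanish`, `bSpan_iff_bNonvanish`, `bNonvanish_iff`).
Mathlib: `Submodule.span_le`, `Submodule.span_induction`, `Submodule.span_mono`.
-/

open Finset

namespace Literature.Probability.Percolation.MarkedLoops

open Literature.Probability.Percolation Literature.Probability.LatticeModels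
open Literature.Probability.LatticeModels.TemperleyLieb
open TriMarkedDomain

/-! ### The corner-pair criterion along a sub-family -/

section Subfamily

variable {m : ℕ}

/-- ★★ **THE CORNER-PAIR STABILITY CRITERION ALONG A SUB-FAMILY**: if the span of the home-arc laws of a family `T` of lawpoints of `(2m+1)`-marked domains is stable under every
corner-pair generator `e_j`, `j ≤ 2m−1`, and some pattern is realised at a member of `T`, then `BNonvanish (2m+1)` holds on the home arc (the laws of `T` alone already span the
planar module). [cite: KhristoforovSmirnov2021, §2 Lemma 4 (arXiv v1 p. 4), eq. (4) and Remark 6 (p. 5); RidoutSaintAubin2014TL, §3 Prop. 3.3 (arXiv p. 13); PearceRittenbergDeGierNienhuis2002, §2] -/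
theorem bNonvanish_of_subfamily_stable_corners (T : Set (Σ D : TriMarkedDomain (2 * m + 1), ArcPoint D (Fin.last (2 * m))))
    (hstab : ∀ (j : Fin (2 * m + 1)), j.val < 2 * m → ∀ zz : T,
      tlL ℂ 1 j (lawLP zz.1.2) ∈ Submodule.span ℂ (Set.range fun ww : T => lawLP ww.1.2))
    (h0 : ∃ zz : T, ∃ q : Pat₀ (2 * m + 1), patternCount zz.1.1 zz.1.2.v zz.1.2.i q.1 ≠ 0) :
    BNonvanish (2 * m + 1) (Fin.last (2 * m)) := by
  obtain ⟨zz₀, q₀, hq₀⟩ := h0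
  have hT : Submodule.span ℂ (Set.range fun ww : T => lawLP ww.1.2) = ⊤ :=
    span_eq_top_of_stable_initial (fun ww : T => lawLP ww.1.2) hstab (i₀ := zz₀) (totalMass_lawLP_ne_zero zz₀.1.2 hq₀)
  rw [bNonvanish_last_iff_span_lawLP, ← top_le_iff, ← hT]
  refine Submodule.span_le.2 ?_
  rintro _ ⟨ww, rfl⟩
  exact Submodule.subset_span ⟨ww.1, rfl⟩

/-- ★★ **… and boundary span on the home arc.** [cite: KhristoforovSmirnov2021, §2 eq. (4) and Remark 6 (arXiv v1 p. 5); RidoutSaintAubin2014TL, §3 Prop. 3.3 (arXiv p. 13)] -/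
theorem bSpan_of_subfamily_stable_corners (T : Set (Σ D : TriMarkedDomain (2 * m + 1), ArcPoint D (Fin.last (2 * m))))
    (hstab : ∀ (j : Fin (2 * m + 1)), j.val < 2 * m → ∀ zz : T,
      tlL ℂ 1 j (lawLP zz.1.2) ∈ Submodule.span ℂ (Set.range fun ww : T => lawLP ww.1.2))
    (h0 : ∃ zz : T, ∃ q : Pat₀ (2 * m + 1), patternCount zz.1.1 zz.1.2.v zz.1.2.i q.1 ≠ 0) :
    BSpan (2 * m + 1) (Fin.last (2 * m)) :=
  (bSpan_iff_bNonvanish _).2 (bNonvanish_of_subfamily_stable_corners T hstab h0)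

/-- ★★ **… on EVERY arc** (`k = 2m+3 ≥ 3`). [cite: KhristoforovSmirnov2021, §1.2 (arXiv v1 p. 2: cyclic indexing); §2 eq. (4) (p. 5); RidoutSaintAubin2014TL, §3 Prop. 3.3 (arXiv p. 13)] -/
theorem bSpan_of_subfamily_stable_corners' {m : ℕ} (T : Set (Σ D : TriMarkedDomain (2 * (m + 1) + 1), ArcPoint D (Fin.last (2 * (m + 1)))))
    (hstab : ∀ (j : Fin (2 * (m + 1) + 1)), j.val < 2 * (m + 1) → ∀ zz : T,
      tlL ℂ 1 j (lawLP zz.1.2) ∈ Submodule.span ℂ (Set.range fun ww : T => lawLP ww.1.2))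
    (h0 : ∃ zz : T, ∃ q : Pat₀ (2 * (m + 1) + 1), patternCount zz.1.1 zz.1.2.v zz.1.2.i q.1 ≠ 0)
    (a : Fin (2 * (m + 1) + 1)) : BSpan (2 * (m + 1) + 1) a ∧ BNonvanish (2 * (m + 1) + 1) a := by
  have h := bNonvanish_of_subfamily_stable_corners T hstab h0
  have ha : BNonvanish (2 * (m + 1) + 1) a := (bNonvanish_iff (n := 2 * m + 1) a (Fin.last (2 * (m + 1)))).2 h
  exact ⟨(bSpan_iff_bNonvanish a).2 ha, ha⟩

end Subfamily

/-! ### The sideways tower -/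

section Sideways

variable {R : Type*} [CommRing R] {n : ℕ}

/-- ★ **THE SIDEWAYS TOWER (algebraic skeleton)**: at loop weight `1`, if `contractL j L₀ = X₁ − X₀`, `capInsL j X₀ = L_h − L₀` and `capInsL j X₁ = L₂ − L₁`, then
`e_j L₀ = L₂ − L₁ − L_h + L₀` (`e_j = capInsL j ∘ contractL j`). In the lane: `X₀`, `X₁` are the laws of `Ω` and `Ω ∪ h` with the tight pair unmarked (F2), `L_h` the pair moved
onto `h` (F1), `L₁`, `L₂` the F1 pair of a second hexagon attached BESIDE `h` — four laws of admissible domains of the same level.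
[cite: PearceRittenbergDeGierNienhuis2002, §2 ((monoid): the cup–cap move `e_j`)] -/
theorem tlL_one_eq_sideways (j : Fin (n + 1)) {L₀ Lh L₁ L₂ : LinkPattern (n + 1 + 1) →₀ R} {X₀ X₁ : LinkPattern n →₀ R}
    (hF2 : contractL R j L₀ = X₁ - X₀) (hF1 : capInsL R j X₀ = Lh - L₀) (hF1' : capInsL R j X₁ = L₂ - L₁) :
    tlL R (1 : R) j L₀ = L₂ - L₁ - Lh + L₀ := by
  rw [tlL_one_eq_capInsL_comp_contractL, LinearMap.comp_apply, hF2, map_sub, hF1, hF1']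
  abel

/-- ★ **… hence `e_j L₀` lies in any subspace containing the four laws.** [cite: PearceRittenbergDeGierNienhuis2002, §2 ((monoid): the cup–cap move `e_j`)] -/
theorem tlL_one_mem_of_sideways (j : Fin (n + 1)) {W : Submodule R (LinkPattern (n + 1 + 1) →₀ R)} {L₀ Lh L₁ L₂ : LinkPattern (n + 1 + 1) →₀ R}
    {X₀ X₁ : LinkPattern n →₀ R} (hF2 : contractL R j L₀ = X₁ - X₀) (hF1 : capInsL R j X₀ = Lh - L₀) (hF1' : capInsL R j X₁ = L₂ - L₁)
    (h₀ : L₀ ∈ W) (hh : Lh ∈ W) (h₁ : L₁ ∈ W) (h₂ : L₂ ∈ W) : tlL R (1 : R) j L₀ ∈ W := by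
  rw [tlL_one_eq_sideways j hF2 hF1 hF1']
  exact W.add_mem (W.sub_mem (W.sub_mem h₂ h₁) hh) h₀

end Sideways

/-! ### The assembly criterion: tightening + sideways towers -/

section Assembly

variable {m : ℕ}

/-- ★★★ **BOUNDARY NON-DEGENERACY FROM TIGHTENING AND SIDEWAYS TOWERS.** Let `T` be a family of home-arc lawpoints of `(2m+1)`-marked domains with one realised pattern. Suppose
that for every corner pair `j ≤ 2m−1` and every `z ∈ T` the law `lawLP z` lies in the span of the laws of the members `w ∈ T` which are SIDEWAYS TOWER-ABLE AT `j` INSIDE `T`: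
there are `X₀, X₁` in the planar module of `2m` sites and members `w_h, w₁, w₂ ∈ T` with `contractL j (lawLP w) = X₁ − X₀`, `capInsL j X₀ = lawLP w_h − lawLP w`,
`capInsL j X₁ = lawLP w₂ − lawLP w₁` (TIGHTENING). Then `BNonvanish (2m+1)` on the home arc. [cite: KhristoforovSmirnov2021, §2 Lemma 4 (arXiv v1 p. 4), eq. (4) and Remark 6 (p. 5); RidoutSaintAubin2014TL, §3 Prop. 3.3 (arXiv p. 13); PearceRittenbergDeGierNienhuis2002, §2] -/
theorem bNonvanish_of_tighten_sideways (T : Set (Σ D : TriMarkedDomain (2 * m + 1), ArcPoint D (Fin.last (2 * m))))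
    (h0 : ∃ zz : T, ∃ q : Pat₀ (2 * m + 1), patternCount zz.1.1 zz.1.2.v zz.1.2.i q.1 ≠ 0)
    (htight : ∀ (j : Fin (2 * m + 1)), j.val < 2 * m → ∀ zz : T,
      lawLP zz.1.2 ∈ Submodule.span ℂ (Set.range fun ww : {ww : T //
          ∃ (X₀ X₁ : LinkPattern (2 * m) →₀ ℂ) (wh w₁ w₂ : T), contractL ℂ j (lawLP ww.1.2) = X₁ - X₀ ∧
            capInsL ℂ j X₀ = lawLP wh.1.2 - lawLP ww.1.2 ∧ capInsL ℂ j X₁ = lawLP w₂.1.2 - lawLP w₁.1.2} => lawLP ww.1.1.2)) :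
    BNonvanish (2 * m + 1) (Fin.last (2 * m)) := by
  refine bNonvanish_of_subfamily_stable_corners T (fun j hj zz => ?_) h0
  set W := Submodule.span ℂ (Set.range fun ww : T => lawLP ww.1.2) with hW
  -- `e_j` of every tower-able member lies in `W`; by linearity so does `e_j` of everything in their span
  have key : ∀ x, x ∈ Submodule.span ℂ (Set.range fun ww : {ww : T //
      ∃ (X₀ X₁ : LinkPattern (2 * m) →₀ ℂ) (wh w₁ w₂ : T), contractL ℂ j (lawLP ww.1.2) = X₁ - X₀ ∧
        capInsL ℂ j X₀ = lawLP wh.1.2 - lawLP ww.1.2 ∧ capInsL ℂ j X₁ = lawLP w₂.1.2 - lawLP w₁.1.2} => lawLP ww.1.1.2) → tlL ℂ 1 j x ∈ W := by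
    intro x hx
    refine Submodule.span_induction ?_ ?_ ?_ ?_ hx
    · rintro _ ⟨⟨ww, X₀, X₁, wh, w₁, w₂, hF2, hF1, hF1'⟩, rfl⟩
      exact tlL_one_mem_of_sideways j hF2 hF1 hF1' (Submodule.subset_span ⟨ww, rfl⟩) (Submodule.subset_span ⟨wh, rfl⟩)
        (Submodule.subset_span ⟨w₁, rfl⟩) (Submodule.subset_span ⟨w₂, rfl⟩)
    · rw [map_zero]; exact W.zero_mem
    · intro x y _ _ hx hy; rw [map_add]; exact W.add_mem hx hy
    · intro c x _ hx; rw [map_smul]; exact W.smul_mem c hx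
  exact key _ (htight j hj zz)

/-- ★★★ **… AND BOUNDARY SPAN ON EVERY ARC** (`k = 2m+3 ≥ 3`). [cite: KhristoforovSmirnov2021, §1.2 (arXiv v1 p. 2: cyclic indexing); §2 eq. (4) and Remark 6 (p. 5); RidoutSaintAubin2014TL, §3 Prop. 3.3 (arXiv p. 13)] -/
theorem bSpan_of_tighten_sideways' {m : ℕ} (T : Set (Σ D : TriMarkedDomain (2 * (m + 1) + 1), ArcPoint D (Fin.last (2 * (m + 1)))))
    (h0 : ∃ zz : T, ∃ q : Pat₀ (2 * (m + 1) + 1), patternCount zz.1.1 zz.1.2.v zz.1.2.i q.1 ≠ 0)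
    (htight : ∀ (j : Fin (2 * (m + 1) + 1)), j.val < 2 * (m + 1) → ∀ zz : T,
      lawLP zz.1.2 ∈ Submodule.span ℂ (Set.range fun ww : {ww : T //
          ∃ (X₀ X₁ : LinkPattern (2 * (m + 1)) →₀ ℂ) (wh w₁ w₂ : T), contractL ℂ j (lawLP ww.1.2) = X₁ - X₀ ∧
            capInsL ℂ j X₀ = lawLP wh.1.2 - lawLP ww.1.2 ∧ capInsL ℂ j X₁ = lawLP w₂.1.2 - lawLP w₁.1.2} => lawLP ww.1.1.2))
    (a : Fin (2 * (m + 1) + 1)) : BSpan (2 * (m + 1) + 1) a ∧ BNonvanish (2 * (m + 1) + 1) a := by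
  have h := bNonvanish_of_tighten_sideways T h0 htight
  have ha : BNonvanish (2 * (m + 1) + 1) a := (bNonvanish_iff (n := 2 * m + 1) a (Fin.last (2 * (m + 1)))).2 h
  exact ⟨(bSpan_iff_bNonvanish a).2 ha, ha⟩

end Assembly

end Literature.Probability.Percolation.MarkedLoops
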